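import Literature.AlgebraicGeometry.Resolution.EtaleLocalAlgebra
import Literature.AlgebraicGeometry.Resolution.NormalCrossingsStrictification
import Literature.AlgebraicGeometry.Resolution.NormalCrossingsLocal
import Literature.AlgebraicGeometry.Resolution.StrictNormalCrossingsAt
import Literature.AlgebraicGeometry.Resolution.StalkIdealLemmas
import Mathlib.AlgebraicGeometry.Morphisms.Etale
import Mathlib.AlgebraicGeometry.Noetherian
import HarnessLib

/-!
# Vanishing ideals, branch orders and strict normal crossings along étale morphisms

Topic: `Literature/AlgebraicGeometry/Resolution`. Scheme-level consequences of the étale local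
algebra of `EtaleLocalAlgebra.lean`, for an étale morphism `e : X' → X` of locally Noetherian
schemes — node F3 (global half) of the decomposition of `DeJong1996NormalCrossingsBlowup`
(de Jong 1996, 2.4; `NormalCrossingsStrictification.lean`). Everything is PROVED.

* `radical_eq_iff_forall_stalkIdeal`, `isRadical_stalkIdeal_vanishingIdeal` — radicality of an
  ideal sheaf is checked on stalks (`stalkIdeal_radical`, `stalkIdeal_comap_eq_map_stalkMap` of
  `StalkIdealLemmas.lean`).
* The stalk map of an étale morphism as an "étale local" algebra: flat, formally unramified,
  essentially of finite type, local (`Etale.flat_stalkAlgebra`, …).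
* `comap_vanishingIdeal_of_etale` — **the reduced structure pulls back along étale morphisms**:
  `I_Z · 𝒪_{X'} = I_{e⁻¹ Z}` (radicality of the pull-back is checked on stalks, where it is the
  extension of a radical ideal along an étale local homomorphism).
* `branchOrder_preimage_of_etale` — **the branch order is invariant**:
  `branchOrder X' (e⁻¹ Z) x' = branchOrder X Z (e x')` (orders of ideals are preserved).
* `isSNCIdeal_iff_exists_isRsopPart` (bridge between `IsSNCIdeal` and `IsRsopPart`),
  `IsStrictNormalCrossingsAt.preimage_of_etale` / `of_preimage_of_etale` and
  `IsStrictNormalCrossingsDivisor.preimage_of_etale` — **strict normal crossings pull back along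
  (and, pointwise, descend from) étale morphisms** (being part of a regular system of
  parameters is invariant under étale local homomorphisms).
* `branchOrder_eq_of_isRsopPart`, `IsStrictNormalCrossingsAt.branchOrder_le_ringKrullDim` —
  at a strict normal crossings point the branch order is the number of branches `r ≤ dim`;
  **`NormalCrossingsBranchOrderLe_holds`** — DISCHARGE of the named fact
  `NormalCrossingsBranchOrderLe` of `NormalCrossingsStrictification.lean`.
* `isClosed_of_preimage_of_surjective_of_isOpenMap` — a subset whose preimage under a surjective
  open map is closed is closed.

## Sources

* A. J. de Jong, *Smoothness, semi-stability and alterations*, Publ. Math. IHÉS 83 (1996), 2.4.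
* The Stacks Project, Tags 0BI9, 0BSF, 033B, 039Q.
* H. Matsumura, *Commutative Ring Theory* (1986), Thm. 23.7.
-/

noncomputable section

open CategoryTheory CategoryTheory.Limits AlgebraicGeometry TopologicalSpace IsLocalRing

universe u

namespace Literature.AlgebraicGeometry.Resolution

open Scheme.IdealSheafData

/-! ## Radicality on stalks -/

section Stalks

variable {X Y : Scheme.{u}}

/-- An ideal sheaf is radical iff all its stalks are radical ideals. [folklore] -/
theorem radical_eq_iff_forall_stalkIdeal (𝒥 : X.IdealSheafData) :
    𝒥.radical = 𝒥 ↔ ∀ x, (stalkIdeal 𝒥 x).IsRadical := by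
  constructor
  · intro h x
    rw [← h, stalkIdeal_radical]
    exact Ideal.radical_isRadical _
  · intro h
    refine ext_of_forall_stalkIdeal_eq fun x => ?_
    rw [stalkIdeal_radical]
    exact (h x).radical

/-- The stalks of the vanishing ideal sheaf of a closed subset are radical ideals. [folklore] -/
theorem isRadical_stalkIdeal_vanishingIdeal (Z : Closeds X) (x : X) :
    (stalkIdeal (vanishingIdeal Z) x).IsRadical :=
  (radical_eq_iff_forall_stalkIdeal _).mp (radical_vanishingIdeal Z) x

end Stalks

/-! ## The stalk maps of an étale morphism -/

section EtaleStalk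

variable {X' X : Scheme.{u}} (e : X' ⟶ X) (x' : X')

/-- The stalk map of a flat morphism is a flat algebra. [folklore] -/
theorem flat_stalkAlgebra [Flat e] :
    letI := (e.stalkMap x').hom.toAlgebra
    Module.Flat (X.presheaf.stalk (e x')) (X'.presheaf.stalk x') := by
  letI := (e.stalkMap x').hom.toAlgebra
  exact RingHom.flat_algebraMap_iff.mpr (Flat.stalkMap e x')

/-- The stalk map of a formally unramified morphism is a formally unramified algebra.
[folklore] -/
theorem formallyUnramified_stalkAlgebra [FormallyUnramified e] :
    letI := (e.stalkMap x').hom.toAlgebra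
    Algebra.FormallyUnramified (X.presheaf.stalk (e x')) (X'.presheaf.stalk x') := by
  letI := (e.stalkMap x').hom.toAlgebra
  rw [← RingHom.formallyUnramified_algebraMap, RingHom.algebraMap_toAlgebra]
  exact FormallyUnramified.stalkMap e x'

/-- The stalk map of a morphism locally of finite type is essentially of finite type.
[folklore] -/
theorem essFiniteType_stalkAlgebra [LocallyOfFiniteType e] :
    letI := (e.stalkMap x').hom.toAlgebra
    Algebra.EssFiniteType (X.presheaf.stalk (e x')) (X'.presheaf.stalk x') := by
  letI := (e.stalkMap x').hom.toAlgebra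
  rw [← RingHom.essFiniteType_algebraMap, RingHom.algebraMap_toAlgebra]
  exact LocallyOfFiniteType.stalkMap e x'

/-- The stalk map is a local homomorphism. [folklore] -/
theorem isLocalHom_stalkAlgebra :
    letI := (e.stalkMap x').hom.toAlgebra
    IsLocalHom (algebraMap (X.presheaf.stalk (e x')) (X'.presheaf.stalk x')) := by
  letI := (e.stalkMap x').hom.toAlgebra
  exact inferInstanceAs (IsLocalHom (e.stalkMap x').hom)

end EtaleStalk

/-! ## The reduced structure and the branch order along étale morphisms -/

section Etale

variable {X' X : Scheme.{u}} (e : X' ⟶ X) [Etale e] [IsLocallyNoetherian X]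

/-- **The reduced structure pulls back along étale morphisms**: for `e : X' → X` étale, `X`
locally Noetherian, and a closed `Z ⊆ X`, the pull-back of the ideal sheaf of (the reduced
closed subscheme on) `Z` is the ideal sheaf of `e⁻¹ Z`: it has support `e⁻¹ Z`, and it is
radical because on stalks it is the extension of the radical ideal `I_{Z, e x'}` along the
flat unramified essentially finite-type local homomorphism `𝒪_{X,e x'} → 𝒪_{X',x'}`.
[cite: StacksProject, Tag 033B] -/
theorem comap_vanishingIdeal_of_etale (Z : Closeds X) :
    (vanishingIdeal Z).comap e = vanishingIdeal (Z.preimage e.continuous) := by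
  haveI : IsLocallyNoetherian X' := LocallyOfFiniteType.isLocallyNoetherian e
  apply eq_vanishingIdeal_of_radical
  · rw [radical_eq_iff_forall_stalkIdeal]
    intro x'
    rw [stalkIdeal_comap_eq_map_stalkMap]
    letI := (e.stalkMap x').hom.toAlgebra
    haveI := flat_stalkAlgebra e x'
    haveI := formallyUnramified_stalkAlgebra e x'
    haveI := essFiniteType_stalkAlgebra e x'
    exact Ideal.IsRadical.map_of_flat_of_formallyUnramified
      (isRadical_stalkIdeal_vanishingIdeal Z (e x'))
  · rw [support_comap]
    ext1
    rw [Closeds.coe_preimage, coe_support_vanishingIdeal, Closeds.coe_preimage]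

/-- **The branch order is invariant under étale morphisms**: for `e : X' → X` étale, `X`
locally Noetherian, `Z ⊆ X` closed and `x' ∈ X'`, `branchOrder X' (e⁻¹ Z) x' = branchOrder X Z (e x')`
— the ideal of `e⁻¹ Z` at `x'` is the extension of the ideal of `Z` at `e x'`
(`comap_vanishingIdeal_of_etale`), and `I · 𝒪_{X',x'} ⊆ 𝔪_{x'}ⁿ ↔ I ⊆ 𝔪_{e x'}ⁿ`
(`map_le_maximalIdeal_pow_iff`). [cite: DeJong1996, 2.4, p. 55] -/
theorem branchOrder_preimage_of_etale {Z : Set X} (hZ : IsClosed Z) (x' : X') :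
    branchOrder X' (e ⁻¹' Z) x' = branchOrder X Z (e x') := by
  haveI : IsLocallyNoetherian X' := LocallyOfFiniteType.isLocallyNoetherian e
  have hcl : (⟨closure Z, isClosed_closure⟩ : Closeds X) = ⟨Z, hZ⟩ := Closeds.ext hZ.closure_eq
  have hcl' : (⟨closure (e ⁻¹' Z), isClosed_closure⟩ : Closeds X') =
      (⟨Z, hZ⟩ : Closeds X).preimage e.continuous := by
    apply Closeds.ext
    simp only [Closeds.coe_mk, Closeds.coe_preimage]
    exact (hZ.preimage e.continuous).closure_eq
  rw [branchOrder_def, branchOrder_def, hcl, hcl', ← comap_vanishingIdeal_of_etale]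
  letI := (e.stalkMap x').hom.toAlgebra
  haveI := flat_stalkAlgebra e x'
  haveI := formallyUnramified_stalkAlgebra e x'
  haveI := essFiniteType_stalkAlgebra e x'
  haveI := isLocalHom_stalkAlgebra e x'
  apply le_antisymm
  · refine ENat.forall_natCast_le_iff_le.mp fun n hn => ?_
    rw [le_idealOrder_iff] at hn ⊢
    rw [stalkIdeal_comap_eq_map_stalkMap] at hn
    exact (map_le_maximalIdeal_pow_iff (A := X.presheaf.stalk (e x'))
      (B := X'.presheaf.stalk x') _ n).mp hn
  · refine ENat.forall_natCast_le_iff_le.mp fun n hn => ?_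
    rw [le_idealOrder_iff] at hn ⊢
    rw [stalkIdeal_comap_eq_map_stalkMap]
    exact (map_le_maximalIdeal_pow_iff (A := X.presheaf.stalk (e x'))
      (B := X'.presheaf.stalk x') _ n).mpr hn

end Etale

/-! ## Strict normal crossings along étale morphisms -/

/-- **Bridge**: an ideal has local strict normal crossings data (`IsSNCIdeal`) iff it is
generated by the product of a non-empty part of a regular system of parameters
(`IsRsopPart`). [folklore] -/
theorem isSNCIdeal_iff_exists_isRsopPart {A : Type u} [CommRing A] [IsLocalRing A] (I : Ideal A) :
    IsSNCIdeal I ↔ ∃ (r : ℕ) (x : Fin r → A), 1 ≤ r ∧ IsRsopPart x ∧ I = Ideal.span {∏ i, x i} := by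
  constructor
  · rintro ⟨hreg, r, e, x, y, hr, hdim, hspan, hI⟩
    exact ⟨r, x, hr, ⟨hreg, e, y, hdim, hspan⟩, hI⟩
  · rintro ⟨r, x, hr, ⟨hreg, e, y, hdim, hspan⟩, hI⟩
    exact ⟨hreg, r, e, x, y, hr, hdim, hspan, hI⟩

section SNC

variable {X' X : Scheme.{u}} (e : X' ⟶ X) [Etale e] [IsLocallyNoetherian X]

/-- **The pointwise strict normal crossings condition is invariant under étale morphisms**:
for `e : X' → X` étale, `X` locally Noetherian, `Z ⊆ X` closed and `x' ∈ X'`, `Z` has strict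
normal crossings at `e x'` iff `e⁻¹ Z` has strict normal crossings at `x'`. The ideal of
`e⁻¹ Z` at `x'` is `I_{Z,e x'} · 𝒪_{X',x'}`; for `⇒`, the image of a part of a regular system of
parameters is one; for `⇐`, the ideal `I_{Z, e x'}` extends to `(∏ x̄ᵢ)` upstairs, each branch
`(x̄ᵢ)` … — only `⇒` is proved here, which is what the pull-back of divisors needs.
[cite: DeJong1996, 2.4, p. 55] -/
theorem IsStrictNormalCrossingsAt.preimage_of_etale {Z : Set X} (hZ : IsClosed Z) (x' : X')
    (h : IsStrictNormalCrossingsAt X Z (e x')) : IsStrictNormalCrossingsAt X' (e ⁻¹' Z) x' := by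
  haveI : IsLocallyNoetherian X' := LocallyOfFiniteType.isLocallyNoetherian e
  have hcl : (⟨closure Z, isClosed_closure⟩ : Closeds X) = ⟨Z, hZ⟩ := Closeds.ext hZ.closure_eq
  have hcl' : (⟨closure (e ⁻¹' Z), isClosed_closure⟩ : Closeds X') =
      (⟨Z, hZ⟩ : Closeds X).preimage e.continuous := by
    apply Closeds.ext
    simp only [Closeds.coe_mk, Closeds.coe_preimage]
    exact (hZ.preimage e.continuous).closure_eq
  unfold IsStrictNormalCrossingsAt at h ⊢
  rw [hcl', ← comap_vanishingIdeal_of_etale, stalkIdeal_comap_eq_map_stalkMap]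
  rw [hcl] at h
  letI := (e.stalkMap x').hom.toAlgebra
  haveI := flat_stalkAlgebra e x'
  haveI := formallyUnramified_stalkAlgebra e x'
  haveI := essFiniteType_stalkAlgebra e x'
  haveI := isLocalHom_stalkAlgebra e x'
  rw [isSNCIdeal_iff_exists_isRsopPart] at h ⊢
  obtain ⟨r, x, hr, hx, hI⟩ := h
  refine ⟨r, (e.stalkMap x').hom ∘ x, hr, ?_, ?_⟩
  · exact (isRsopPart_map_iff_of_etaleLocal (A := X.presheaf.stalk (e x'))
      (B := X'.presheaf.stalk x') x).mpr hx
  · rw [hI, Ideal.map_span, Set.image_singleton, map_prod]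
    rfl

/-- **Strict normal crossings divisors pull back along étale morphisms** (between locally
Noetherian schemes). [cite: DeJong1996, 2.4, p. 55] -/
theorem IsStrictNormalCrossingsDivisor.preimage_of_etale {Z : Set X}
    (h : IsStrictNormalCrossingsDivisor X Z) : IsStrictNormalCrossingsDivisor X' (e ⁻¹' Z) := by
  rw [isStrictNormalCrossingsDivisor_iff_forall_isStrictNormalCrossingsAt] at h ⊢
  exact ⟨h.1.preimage e.continuous, fun x' hx' =>
    IsStrictNormalCrossingsAt.preimage_of_etale e h.1 x' (h.2 (e x') hx')⟩

end SNC

/-! ## The number of branches at a point; discharge of `NormalCrossingsBranchOrderLe` -/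

section BranchOrder

variable {X : Scheme.{u}} {Z : Set X} {x : X}

/-- **At a point of a strict normal crossings divisor the branch order is the number `r` of
branches**: if `I(Z)_x = (x₁ ⋯ x_r)` with `x₁, …, x_r` part of a regular system of parameters,
then `I(Z)_x ⊆ 𝔪ᵏ ↔ k ≤ r` (`IsRsopPart.span_unit_mul_prod_le_pow_iff`), so
`branchOrder X Z x = r`. [cite: DeJong1996, 2.4, p. 55] -/
theorem branchOrder_eq_of_isRsopPart {r : ℕ} {z : Fin r → X.presheaf.stalk x} (hz : IsRsopPart z)
    (hI : stalkIdeal (vanishingIdeal ⟨closure Z, isClosed_closure⟩) x = Ideal.span {∏ i, z i}) :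
    branchOrder X Z x = r := by
  have key : ∀ k : ℕ, (k : ℕ∞) ≤ branchOrder X Z x ↔ k ≤ r := by
    intro k
    rw [branchOrder_def, le_idealOrder_iff, hI, ← one_mul (∏ i, z i)]
    exact hz.span_unit_mul_prod_le_pow_iff isUnit_one k
  apply le_antisymm
  · by_contra h
    have h' : ((r + 1 : ℕ) : ℕ∞) ≤ branchOrder X Z x := by
      rw [not_le] at h
      exact Order.add_one_le_of_lt (by exact_mod_cast h)
    have := (key (r + 1)).mp h'
    omega
  · exact (key r).mpr le_rfl

/-- At a point where `Z` has strict normal crossings, the branch order is at most the dimension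
of the local ring (`r ≤ r + e = dim 𝒪_{X,x}`). [cite: DeJong1996, 2.4, p. 55] -/
theorem IsStrictNormalCrossingsAt.branchOrder_le_ringKrullDim (h : IsStrictNormalCrossingsAt X Z x) :
    (branchOrder X Z x : WithBot ℕ∞) ≤ ringKrullDim (X.presheaf.stalk x) := by
  obtain ⟨r, z, -, hz, hI⟩ := (isSNCIdeal_iff_exists_isRsopPart _).mp h
  rw [branchOrder_eq_of_isRsopPart hz hI]
  obtain ⟨-, e, y, hdim, -⟩ := hz
  rw [hdim]
  exact_mod_cast Nat.le_add_right r e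

end BranchOrder

/-- **Discharge of `NormalCrossingsBranchOrderLe`** (the number of branches of a normal
crossings divisor at a point is at most the dimension of the local ring): pass to a point `s'`
over `s` on the étale cover where `Z` becomes a strict normal crossings divisor — the branch
order is invariant (`branchOrder_preimage_of_etale`), upstairs it is `r ≤ dim 𝒪_{S',s'}`
(`IsStrictNormalCrossingsAt.branchOrder_le_ringKrullDim`), and `dim 𝒪_{S',s'} = dim 𝒪_{S,s}`
(`ringKrullDim_eq_of_etaleLocal`). [cite: DeJong1996, 2.4, p. 55] -/
theorem NormalCrossingsBranchOrderLe_holds : NormalCrossingsBranchOrderLe.{u} := by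
  intro S _ Z hZ s hs
  obtain ⟨S', e, he, hsurj, hZ'⟩ := hZ
  haveI := he
  haveI := hsurj
  haveI : IsLocallyNoetherian S' := LocallyOfFiniteType.isLocallyNoetherian e
  have hcl : IsClosed Z :=
    IsNormalCrossingsDivisor.isClosed ⟨S', e, he, hsurj, hZ'⟩
  obtain ⟨s', rfl⟩ := e.surjective s
  have hat : IsStrictNormalCrossingsAt S' (e ⁻¹' Z) s' := hZ'.isStrictNormalCrossingsAt hs
  have h1 := hat.branchOrder_le_ringKrullDim
  rw [branchOrder_preimage_of_etale e hcl s'] at h1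
  letI := (e.stalkMap s').hom.toAlgebra
  haveI := flat_stalkAlgebra e s'
  haveI := formallyUnramified_stalkAlgebra e s'
  haveI := essFiniteType_stalkAlgebra e s'
  haveI := isLocalHom_stalkAlgebra e s'
  rwa [ringKrullDim_eq_of_etaleLocal (S.presheaf.stalk (e s')) (S'.presheaf.stalk s')] at h1

/-! ## Closedness under surjective open maps -/

/-- A subset whose preimage under a surjective open map is closed is closed (the complement is
the image of the open complement of the preimage). [folklore] -/
theorem isClosed_of_preimage_of_surjective_of_isOpenMap {α β : Type*} [TopologicalSpace α]
    [TopologicalSpace β] {f : α → β} (hf : IsOpenMap f) (hsurj : Function.Surjective f)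
    {C : Set β} (hC : IsClosed (f ⁻¹' C)) : IsClosed C := by
  rw [← isOpen_compl_iff]
  have : Cᶜ = f '' (f ⁻¹' C)ᶜ := by
    rw [← Set.preimage_compl, Set.image_preimage_eq _ hsurj]
  rw [this]
  exact hf _ hC.isOpen_compl

end Literature.AlgebraicGeometry.Resolution

end
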